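import Mathlib

/-!
# UnipotentIsoSharpLaw — kernel shadow of RULE U-ISO♯ (hsemireg-alphabet-unipotent-1, generation g8)

TOKEN `line stmt-HodgeConjecture-18881 Cruxes/BlochSeedDiscOne/Lines/birth.lean 814a6a70c14e831a stub_rung_pad4_seedAt`.

EVIDENCE-CLASS ARITHMETIC ONLY.  This file proves nothing toward `stub_rung_pad4_seedAt`, 18881, H2, №4, 26512,
HC_AV, HC_CM or HC.  It is the Mathlib-only skeleton of the counting law in memo `U-ISO-SHARP-unipotent1-g8.md`:

* `af_floor` — the ALPHABET-FREE floor of §2: for a 1-isolated cell typed with classes `i` of multiplicity `m i ≥ 1`,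
  rank `D i ≥ 1`, pairwise Hom-products `G i j ≥ 1` with `D i ≤ G i i` (LEMMA E of the memo, Motzkin–Taussky–Gerstenhaber,
  is the INPUT `hD`, not proved here):  `Σ m_i D_i + (Σ m_i)² ≤ Σ_i Σ_j m_i m_j G_ij + Σ m_i`, i.e. `Q_X ≥ M_X − N_X + N_X²`.
* `dir_factor` — the per-factor scalar inequality behind the DIRECTION LAW of §3 (`(A−1+min a b)/(ab) ≥ (A−1+R)/R²`,
  cleared of denominators).
* the DIGITS of §4 on the killer family `N{4I+4l_c, 10I+l_c′, 12I, 12I}` of the bd78f9c7-like supports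
  (M = 176 695, B₀₀₁₁ = 12, c₀₀₁₁ = 4, door 5 572): dead at scales 1, 2, 3 for factor ranks ≤ 4, the survival window
  `[2761, 2789]` at scale 4, the direction threshold `A = 110 ∕ 111` at factor rank 4 and `R = 5 ∕ 6` at `A = 4`.

No `sorry`, no new axioms, no `set_option allowUnsafeReducibility`.

v1.1 (g10, 2026-08-30): `set_option linter.dupNamespace false` added before `namespace` (critic rider w3, INBOX l.9064); statements and proofs unchanged.
-/

set_option linter.dupNamespace false

namespace Summit.HodgeConjecture.HodgeConjecture.Cruxes.BlochSeedDiscOne.UnipotentIsoSharpLaw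

open Finset BigOperators

/-! ## §2  the alphabet-free floor -/

/-- Pointwise comparison used in `af_floor` on the diagonal: `m² G + m ≥ m² + m D` from `1 ≤ m`, `D ≤ G`, `1 ≤ G`
(= `m²(G−D) + m(D−1)(m−1) ≥ 0` when `D ≥ 1`, `m²(G−1) + m ≥ 0` when `D = 0`). -/
theorem af_pointwise (m D G : ℕ) (hm : 1 ≤ m) (hDG : D ≤ G) (hG : 1 ≤ G) :
    m * m + m * D ≤ m * m * G + m := by
  rcases Nat.eq_zero_or_pos D with rfl | hD
  · have : m * m * 1 ≤ m * m * G := Nat.mul_le_mul_left (m * m) hG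
    omega
  · obtain ⟨t, rfl⟩ : ∃ t, G = D + t := ⟨G - D, by omega⟩
    obtain ⟨m', rfl⟩ : ∃ m', m = m' + 1 := ⟨m - 1, by omega⟩
    obtain ⟨D', rfl⟩ : ∃ D', D = D' + 1 := ⟨D - 1, by omega⟩
    nlinarith [Nat.zero_le (m' * m' * D'), Nat.zero_le (m' * m' * t), Nat.zero_le (m' * D'), Nat.zero_le (m' * t), Nat.zero_le t]

/-- ALPHABET-FREE FLOOR (memo §2, COROLLARY AF).  `M_X = Σ m_i D_i`, `N_X = Σ m_i`, `Q_X = Σ_i Σ_j m_i m_j G i j`: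
`M_X + N_X² ≤ Q_X + N_X`. -/
theorem af_floor {ι : Type*} [Fintype ι] [DecidableEq ι] (m D : ι → ℕ) (G : ι → ι → ℕ)
    (hm : ∀ i, 1 ≤ m i) (hD : ∀ i, D i ≤ G i i) (hG : ∀ i j, 1 ≤ G i j) :
    (∑ i, m i * D i) + (∑ i, m i) ^ 2 ≤ (∑ i, ∑ j, m i * m j * G i j) + ∑ i, m i := by
  classical
  -- rewrite both sides as double sums of pointwise terms
  have lhs : (∑ i, m i * D i) + (∑ i, m i) ^ 2
      = ∑ i, ∑ j, (m i * m j + if i = j then m i * D i else 0) := by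
    simp only [sum_add_distrib, sum_ite_eq, mem_univ, if_true, sq, sum_mul_sum]
    ring
  have rhs : (∑ i, ∑ j, m i * m j * G i j) + ∑ i, m i
      = ∑ i, ∑ j, (m i * m j * G i j + if i = j then m i else 0) := by
    simp only [sum_add_distrib, sum_ite_eq, mem_univ, if_true]
  rw [lhs, rhs]
  apply sum_le_sum; intro i _
  apply sum_le_sum; intro j _
  by_cases hij : i = j
  · subst hij; simp only [if_true]
    have := af_pointwise (m i) (D i) (G i i) (hm i) (hD i) (hG i i)
    linarith
  · simp only [hij, if_false, add_zero]
    have := hG i j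
    calc m i * m j = m i * m j * 1 := by ring
      _ ≤ m i * m j * G i j := Nat.mul_le_mul_left _ this

/-- The AF kill test in the form the memo uses: if `Q + N ≥ M + N²` (af_floor) and `N ≥ N₀`, then
`Q ≥ M − N₀ + N₀²`-type bounds follow because `N² − N` is monotone; here the monotonicity step. -/
theorem sq_sub_mono {N₀ N : ℕ} (h : N₀ ≤ N) : N₀ * N₀ - N₀ ≤ N * N - N := by
  have h1 : N₀ * N₀ - N₀ = N₀ * (N₀ - 1) := by
    rw [Nat.mul_sub_one]
  have h2 : N * N - N = N * (N - 1) := by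
    rw [Nat.mul_sub_one]
  rw [h1, h2]
  exact Nat.mul_le_mul h (by omega)

/-! ## §3  the per-factor inequality of the direction law -/

/-- DIRECTION LAW, one factor (memo §3): for `1 ≤ a, b ≤ R` and `1 ≤ A`,
`(A − 1 + min a b) · R² ≥ (A − 1 + R) · a · b`; dividing by `a b R² A` this is
`k(a,b)/(ab) ≥ (A + R − 1)/(A R²)` with `k(a,b) = 1 + (min a b − 1)/A`. -/
theorem dir_factor (A R a b : ℝ) (hA : 1 ≤ A) (ha : 1 ≤ a) (haR : a ≤ R) (hb : 1 ≤ b) (hbR : b ≤ R) :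
    (A - 1 + R) * (a * b) ≤ (A - 1 + min a b) * R ^ 2 := by
  rcases le_total a b with h | h
  · rw [min_eq_left h]
    nlinarith [mul_le_mul haR hbR (by linarith) (by linarith : (0:ℝ) ≤ R), mul_nonneg (by linarith : (0:ℝ) ≤ A - 1) (by nlinarith : (0:ℝ) ≤ R ^ 2 - a * b),
      mul_le_mul_of_nonneg_left hbR (by nlinarith : (0:ℝ) ≤ R * a)]
  · rw [min_eq_right h]
    nlinarith [mul_le_mul haR hbR (by linarith) (by linarith : (0:ℝ) ≤ R), mul_nonneg (by linarith : (0:ℝ) ≤ A - 1) (by nlinarith : (0:ℝ) ≤ R ^ 2 - a * b),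
      mul_le_mul_of_nonneg_left haR (by nlinarith : (0:ℝ) ≤ R * b)]

/-- The termwise form actually summed in the memo: a pair of atoms of masses `x = m·D`, `x' = m'·D'` contributes
`m m' k ≥ x x' · (A−1+R)/(A R²)` per factor; here as the cleared inequality for one factor with `x = m a`, `x' = m' b`. -/
theorem dir_term (A R a b m m' : ℝ) (hA : 1 ≤ A) (ha : 1 ≤ a) (haR : a ≤ R) (hb : 1 ≤ b) (hbR : b ≤ R)
    (hm : 0 ≤ m) (hm' : 0 ≤ m') :
    (A - 1 + R) * ((m * a) * (m' * b)) ≤ (m * m') * ((A - 1 + min a b) * R ^ 2) := by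
  have h := dir_factor A R a b hA ha haR hb hbR
  have hmm : 0 ≤ m * m' := mul_nonneg hm hm'
  calc (A - 1 + R) * ((m * a) * (m' * b)) = (m * m') * ((A - 1 + R) * (a * b)) := by ring
    _ ≤ (m * m') * ((A - 1 + min a b) * R ^ 2) := mul_le_mul_of_nonneg_left h hmm

/-! ## §4  digits on the killer family (M = 176 695, B₀₀₁₁ = 12, c₀₀₁₁ = 4, door 5 572)

At scale `s` the AF test reads: dead iff `c (N(N−1) + s M) > s² M B + door` for every admissible `N ≥ ⌈s M / 256⌉`
(factor ranks ≤ 4 ⇒ atom rank ≤ 256). -/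

/-- scale 1: `⌈176695/256⌉ = 691`, and every `N ≥ 691` is killed. -/
theorem killer_s1 (N : ℕ) (hN : 691 ≤ N) : 176695 * 12 + 5572 < 4 * (N * (N - 1) + 176695) := by
  have h : 691 * 690 ≤ N * (N - 1) := Nat.mul_le_mul hN (by omega)
  omega

theorem ceil_s1 : 690 * 256 < 176695 ∧ 176695 ≤ 691 * 256 := by norm_num

/-- scale 2: `⌈353390/256⌉ = 1381`, every `N ≥ 1381` killed. -/
theorem killer_s2 (N : ℕ) (hN : 1381 ≤ N) : 4 * (176695 * 12) + 5572 < 4 * (N * (N - 1) + 2 * 176695) := by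
  have h : 1381 * 1380 ≤ N * (N - 1) := Nat.mul_le_mul hN (by omega)
  omega

theorem ceil_s2 : 1380 * 256 < 2 * 176695 ∧ 2 * 176695 ≤ 1381 * 256 := by norm_num

/-- scale 3: `⌈530085/256⌉ = 2071`, every `N ≥ 2071` killed (thin: margin 179 588 on 19 088 632). -/
theorem killer_s3 (N : ℕ) (hN : 2071 ≤ N) : 9 * (176695 * 12) + 5572 < 4 * (N * (N - 1) + 3 * 176695) := by
  have h : 2071 * 2070 ≤ N * (N - 1) := Nat.mul_le_mul hN (by omega)
  omega

theorem ceil_s3 : 2070 * 256 < 3 * 176695 ∧ 3 * 176695 ≤ 2071 * 256 := by norm_num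

/-- scale 4: the AF law is SILENT — `N = 2761 = ⌈706780/256⌉` up to `N = 2789` pass the test, `N = 2790` does not. -/
theorem window_s4 :
    2760 * 256 < 4 * 176695 ∧ 4 * 176695 ≤ 2761 * 256 ∧
    4 * (2761 * 2760 + 4 * 176695) ≤ 16 * (176695 * 12) + 5572 ∧
    4 * (2789 * 2788 + 4 * 176695) ≤ 16 * (176695 * 12) + 5572 ∧
    16 * (176695 * 12) + 5572 < 4 * (2790 * 2789 + 4 * 176695) := by norm_num

/-- DIRECTION LAW thresholds at factor rank 4: dead at every large scale iff `(A+3)⁴ · M > 3 · (16 A)⁴`;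
`A = 110` dead, `A = 111` alive. -/
theorem dir_threshold_R4 :
    3 * (16 * 110) ^ 4 < 176695 * (110 + 3) ^ 4 ∧ 176695 * (111 + 3) ^ 4 ≤ 3 * (16 * 111) ^ 4 := by norm_num

/-- DIRECTION LAW thresholds for the alphabet of record (`A = 4` chain directions): dead iff `(R+3)⁴ · M > 3·256·R⁸`;
factor rank `5` dead, factor rank `6` alive. -/
theorem dir_threshold_A4 :
    3 * 256 * 5 ^ 8 < 176695 * (5 + 3) ^ 4 ∧ 176695 * (6 + 3) ^ 4 ≤ 3 * 256 * 6 ^ 8 := by norm_num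

/-- U-ISO (g7, `A = ∞`): factor rank 3 dead at every scale (`M > 3·81²... ` i.e. `M > 3 · 3⁸`), factor rank 4 not
(`M ≤ 3 · 4⁸`) — the R* = 3 of record. -/
theorem uiso_R3_R4 : 3 * 3 ^ 8 < 176695 ∧ 176695 ≤ 3 * 4 ^ 8 := by norm_num

end Summit.HodgeConjecture.HodgeConjecture.Cruxes.BlochSeedDiscOne.UnipotentIsoSharpLaw
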